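import Summits.QuantumFields.YangMills.Theorems.BalabanUVNodesN17KeyedRatesFSCJunction
import Summits.QuantumFields.YangMills.Theorems.BalabanUVNodesN17KnitTransfer

/-!
# BalabanUVNodes ∕ node N17 = NE4 — K3⁷ v4's FSC-KEYED STUB-1 RATES, PINNED, FEED NODE U2's OUTPUT UNDER THE TARGETS' PREFIX (the `hU2` slot of
# the N27 ledger joins), AF-FREE and WINDOW-FREE: the two antecedents the extraction needs ARE the prefix's own `(B) → EndpointExistence`

Cell `pub-ymgap` (HUMAN RULINGS D-0062 ∕ D-0149, director-ym №197), WIDTH SEAT `pub-ymgap-dag-n17-w3` (seat 3 of 3 on NODE n17), generation 3, FILE 2; bus INTENT-2.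
THEOREMS ONLY (0 `def`, 0 `instance`, 0 `notation`, 0 `sorry`); filed `--kind proof --supports stmt-QuantumFields-20544 --as helper` (K3⁷ `SpineGivenEndpointR13SepCoPH`);
COUNT-NEUTRAL.  Skeleton of record: plan g82's K3⁷ v4 17c74fac127b5f61 (bodies SPELLED; nothing imported from `Theses/` ∕ `Cruxes/`).

THE POINT (numbers, not adjectives).  FILE 1 (`…N17KeyedRatesFSCJunction`) showed that v4's FSC key changes node N17's INPUT slot by exactly the two antecedents (B) ∧ endpoint
existence.  This file follows node U2 one edge further, to its OUTPUT `Spine.NE4.U2Output D g₀ Cout ρ′` (the two-run coupling discrepancies along the data's runs at `g₀` obey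
`T4CauchySum.InjectedRate Cout 0 ρ′`) — the letter in which the N27 ledger joins of record READ node N17 (`hU2 : D.UnderHypotheses Hβ fun g₀ => U2Output D g₀ Cd θc` of dag-n27-a's
`…N27LedgerJoinN17 ∕ …LedgerJoinTail ∕ …LedgerSyncJoin`).  Since `D.UnderHypotheses Hβ c` IS `(B) → Hβ → ForSmallCouplings D c` (`T4ContinuumYM4Torus.underHypotheses_iff`), at
`Hβ := DagBinding.EndpointExistence D.C.toB12` the two antecedents FILE 1's extraction consumes are SUPPLIED BY THE SLOT ITSELF.  Hence:
* §1 under the node-U3 pin, (D4) ∧ N18 ∧ N22 at ANY bundle of record carry node U2's whole input triple `U2Inputs D (cr·C₅·θ₅) (cr·C₉·ω) ρ θ.γ (cr·moduli)` in the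
  letter READING `ℓ F θ` — `g₀ ∕ os ∕ run-length`-BLIND (dag-n17-a `u2Inputs_of_readOutAt` + the pin; the `PHolderD4`-body form is dag-n17-w3 g2's `u2Inputs_of_pHolderD4_body`)
  — together with the read-out's letter signs;
* §2 ANY FSC-keyed rates predicate `P` PROJECTING TO `ReadOutAt D R.u3 ∧ N18At R.u3 ∧ N22At R.u3` (v4's `PHolderD4` body does; so does any successor edition keeping
  those three conjuncts — the N16 pin of the announced v5 PRECUT touches none of them) + the pin ⟹ that bare triple + signs at every guarded admissible tuple with (B) ∧ endpoint
  (FILE 1 §1 `exists_of_forSmallCouplings`); v4-spelled corollary;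
* §3 ★★ v4's keyed rates + the pin + the PRINTED-type upper bound `BetaUpperH β′ θ.γ β₁₃` with `θ.γ²β′ < 1` (only to run (0.20) forward) + `0 < θ.γ` ⟹ for EVERY output rate
  `ρ′ ∈ ](ℓ F θ).ρ, 1[`: `(datumOfRecord₁₃CoPH F N θ hP).UnderHypotheses (EndpointExistence …) (fun g₀ => U2Output … g₀ (2(cr·C₅·θ₅)∕(1−ρ′)) ρ′)` at every guarded admissible
  tuple — dag-n17-a's AF-FREE, WINDOW-FREE gap road `…BalabanUVNodesN17.u2Output_under_of_u2Inputs_gap` (p41xxxx `…N17KnitTransfer`) fed by §2 INSIDE the prefix.  NO `EventualLowerH`,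
  NO `b`, NO `k₀`, NO γ³-window binder, NO separate (B)∕endpoint hypothesis: the FSC key costs node U2's OUTPUT NOTHING at `Hβ := EndpointExistence`.
* §4 the same from the whole v4 stub-1 ∃-shape (`G` arbitrary but implying the pin): SOME letter reading `ℓ` with §3 at every tuple.
So the N17 → U2 → U6 ∕ N27 edge of record survives the (t9) re-key verbatim; the only letters a consumer still owes are (U) `BetaUpperH` on the record's β ([Balaban1987RG1] (0.20)
p. 256 ∕ Thm 3 p. 264 type, K1⁷ ∕ NODE O business) and the rate loss `ρ ↦ ρ′`.

HONEST SCOPE (A6, director-ym №189).  Quantifier bookkeeping over hypothesis SHAPES; tree roads by name (dag-n17-a `u2Inputs_of_readOutAt` ∕ `u2Output_under_of_u2Inputs_gap`, FILE 1); every hypothesis is 0∕1-inhabited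
at every record today (K0⁷ OPEN; (B), endpoint existence, the K4 rates, (U) are HYPOTHESES); NE4 ∕ NE5 ∕ NE9 ∕ (D4) NOT PRINTED as used and NOT proved; nothing of Bałaban's asserted;
N17 NOT discharged; K3⁷ OPEN (v4, 2 registered stubs, 0 closed) and NOT claimed; counts UNMOVED (typed 28∕28 · discharged 5∕27 · A 5∕28).  One finite four-torus programme at fixed
`ε = L^{−K}`; R4 closes the CONDITIONAL finite-𝕋⁴ rung `BalabanLadder.UV` only — NOT continuum ∕ ℝ⁴ ∕ infinite volume ∕ OS ∕ mass gap; the YM mass gap (Clay) is NOT proved by any of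
this.  Standard axioms.  Supersedes nothing; edits nothing; no decl below carries a cite tag of its own.
-/

namespace YMDAG.N17.KeyedRatesFSC

open Literature.MathematicalPhysics.QuantumFieldTheory.Balaban1983to89
open Literature.MathematicalPhysics.QuantumFieldTheory.Balaban1983to89.T4Continuum
open Literature.MathematicalPhysics.QuantumFieldTheory.Balaban1983to89.T4ContinuumYM4Torus (ForSmallCouplings)
open Literature.MathematicalPhysics.QuantumFieldTheory.Balaban1983to89.FlowStep (BetaUpperH)
open Literature.MathematicalPhysics.QuantumFieldTheory.Balaban1983to89.Node00
open Node00.U3OfKernels (objectsOfRecord₁₃)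
open YMDAG.UVSplit (Datum U3Carriers RateCarriers N17At N18At N22At ReadOutAt RateReading₁₃CoPH rateCarriersOfRecord₁₃CoPH u3OfRecord₁₃)
open Summit.QuantumFields.YangMills.BalabanUVNodes.SpineRatesHolder (RatesHolderAt)
open Summit.QuantumFields.BalabanUV.T4Continuum.Spine.NE4 (U2Inputs U2Output)
open Summit.QuantumFields.YangMills.Theorems.BalabanUVNodesN17 (u2Output_under_of_u2Inputs_gap)
open YMDAG.N17 (u2Inputs_of_readOutAt)

variable {N : ℕ} [NeZero N]

/-! ## §1 Under the pin: node U2's whole triple + the read-out's letter signs off (D4) ∧ N18 ∧ N22 at ANY bundle of record, `g₀`-blind -/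

/-- **(D4) ∧ N18 ∧ N22 AT A PINNED BUNDLE CARRY NODE U2's TRIPLE IN THE LETTER READING** (dag-n17-a `u2Inputs_of_readOutAt` read through the pin; the carriers' letters
`cr C₅ θ₅ C₉ ω ρ moduli` ARE `(ℓ F θ)`'s and the radius IS `θ.γ`, all `rfl` after the pin) — a sentence that reads neither `g₀` nor `os` nor the run length `k`. [bookkeeping] -/
theorem u2Inputs_bare_of_readOut_n18_n22_pin (𝔯 : RateReading₁₃CoPH N) (ℓ : (F : T4Family) → Stage13HParams F N → U3Letters₁₁) {F : T4Family}
    (θ : Stage13HParams F N) (hP : θ.Provisos₁₃CoPH F N)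
    (hpin : ∀ (g₀ : ℕ → ℝ) (os : List (ULoop F)), (𝔯.lit F θ hP g₀ os).u3 = objectsOfRecord₁₃ F N θ.toStage13Params (ℓ F θ))
    (g₀ : ℕ → ℝ) (os : List (ULoop F)) (k : ℕ)
    (hD4 : ReadOutAt (datumOfRecord₁₃CoPH F N θ hP) (rateCarriersOfRecord₁₃CoPH 𝔯 F θ hP g₀ os k).u3) (h18 : N18At (rateCarriersOfRecord₁₃CoPH 𝔯 F θ hP g₀ os k).u3)
    (h22 : N22At (rateCarriersOfRecord₁₃CoPH 𝔯 F θ hP g₀ os k).u3) :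
    U2Inputs (datumOfRecord₁₃CoPH F N θ hP) ((ℓ F θ).cr * (ℓ F θ).C₅ * (ℓ F θ).θ₅) ((ℓ F θ).cr * (ℓ F θ).C₉ * (ℓ F θ).ω) (ℓ F θ).ρ θ.γ
      (fun a i => (ℓ F θ).cr * (ℓ F θ).moduli (a + 1) i) := by
  change ReadOutAt (datumOfRecord₁₃CoPH F N θ hP) (u3OfRecord₁₃ θ.toStage13Params (𝔯.lit F θ hP g₀ os).u3 k) at hD4
  change N18At (u3OfRecord₁₃ θ.toStage13Params (𝔯.lit F θ hP g₀ os).u3 k) at h18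
  change N22At (u3OfRecord₁₃ θ.toStage13Params (𝔯.lit F θ hP g₀ os).u3 k) at h22
  rw [hpin g₀ os] at hD4 h18 h22
  exact u2Inputs_of_readOutAt (datumOfRecord₁₃CoPH F N θ hP) hD4 h18 h22

/-- **… the `PHolderD4`-BODY FORM** (v4's rates predicate SPELLED: `RatesHolderAt D R β ∧ ReadOutAt D R.u3 ∧ (0 ≤ R.u3.ρ ∧ R.u3.ρ < 1)`; (D4), N18, N22 are its conjuncts `.2.1`, `.1.2.2.2.2.1`,
`.1.2.2.2.2.2` — dag-n17-w3 g2 `u2Inputs_of_pHolderD4_body`). [bookkeeping] -/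
theorem u2Inputs_bare_of_pHolderD4_body_pin {β : ℝ} (𝔯 : RateReading₁₃CoPH N) (ℓ : (F : T4Family) → Stage13HParams F N → U3Letters₁₁) {F : T4Family}
    (θ : Stage13HParams F N) (hP : θ.Provisos₁₃CoPH F N)
    (hpin : ∀ (g₀ : ℕ → ℝ) (os : List (ULoop F)), (𝔯.lit F θ hP g₀ os).u3 = objectsOfRecord₁₃ F N θ.toStage13Params (ℓ F θ))
    (g₀ : ℕ → ℝ) (os : List (ULoop F)) (k : ℕ)
    (h : RatesHolderAt (datumOfRecord₁₃CoPH F N θ hP) (rateCarriersOfRecord₁₃CoPH 𝔯 F θ hP g₀ os k) β ∧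
      ReadOutAt (datumOfRecord₁₃CoPH F N θ hP) (rateCarriersOfRecord₁₃CoPH 𝔯 F θ hP g₀ os k).u3 ∧
      (0 ≤ (rateCarriersOfRecord₁₃CoPH 𝔯 F θ hP g₀ os k).u3.ρ ∧ (rateCarriersOfRecord₁₃CoPH 𝔯 F θ hP g₀ os k).u3.ρ < 1)) :
    U2Inputs (datumOfRecord₁₃CoPH F N θ hP) ((ℓ F θ).cr * (ℓ F θ).C₅ * (ℓ F θ).θ₅) ((ℓ F θ).cr * (ℓ F θ).C₉ * (ℓ F θ).ω) (ℓ F θ).ρ θ.γ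
      (fun a i => (ℓ F θ).cr * (ℓ F θ).moduli (a + 1) i) :=
  u2Inputs_bare_of_readOut_n18_n22_pin 𝔯 ℓ θ hP hpin g₀ os k h.2.1 h.1.2.2.2.2.1 h.1.2.2.2.2.2

/-- **… AND THE READ-OUT's LETTER SIGNS** (the sign clauses of (D4) `ReadOutAt` at the pinned bundle, `g₀`-blind): `0 ≤ cr`, `0 ≤ C₅`, `0 ≤ θ₅`, `0 ≤ ω`, `θ₅ ≤ ρ`, `ω ≤ ρ` of `ℓ F θ`.
[bookkeeping] -/
theorem letterSigns_of_readOutAt_pin (𝔯 : RateReading₁₃CoPH N) (ℓ : (F : T4Family) → Stage13HParams F N → U3Letters₁₁) {F : T4Family} (θ : Stage13HParams F N)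
    (hP : θ.Provisos₁₃CoPH F N)
    (hpin : ∀ (g₀ : ℕ → ℝ) (os : List (ULoop F)), (𝔯.lit F θ hP g₀ os).u3 = objectsOfRecord₁₃ F N θ.toStage13Params (ℓ F θ))
    (g₀ : ℕ → ℝ) (os : List (ULoop F)) (k : ℕ) (h : ReadOutAt (datumOfRecord₁₃CoPH F N θ hP) (rateCarriersOfRecord₁₃CoPH 𝔯 F θ hP g₀ os k).u3) :
    0 ≤ (ℓ F θ).cr ∧ 0 ≤ (ℓ F θ).C₅ ∧ 0 ≤ (ℓ F θ).θ₅ ∧ 0 ≤ (ℓ F θ).ω ∧ (ℓ F θ).θ₅ ≤ (ℓ F θ).ρ ∧ (ℓ F θ).ω ≤ (ℓ F θ).ρ := by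
  change ReadOutAt (datumOfRecord₁₃CoPH F N θ hP) (u3OfRecord₁₃ θ.toStage13Params (𝔯.lit F θ hP g₀ os).u3 k) at h
  rw [hpin g₀ os] at h
  obtain ⟨-, -, -, -, -, -, -, -, -, -, -, hcr, hC₅, hθ, hω, hθρ, hωρ⟩ := h
  exact ⟨hcr, hC₅, hθ, hω, hθρ, hωρ⟩

/-! ## §2 ANY FSC-keyed rates predicate `P` projecting to (D4) ∧ N18 ∧ N22, pinned ⟹ the bare triple and the signs at every guarded admissible tuple WITH (B) ∧ endpoint existence -/

section Keyed

variable (Rg : (F : T4Family) → Stage13HParams F N → Prop) (P : ∀ {F : T4Family}, Datum F N → RateCarriers N → Prop)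

/-- ★ **NODE U2's BARE INPUT TRIPLE AT THE RECORD FROM ANY FSC-KEYED RATES PREDICATE `P` UNDER THE PIN** — `P` keyed as v4 keys `PHolderD4` (`guard → Adm → (B) → EndpointExistence →
ForSmallCouplings D (fun g₀ => ∀ os, P D (rr …))`, the `hrates` shape of dag-n19-w3's composer) and PROJECTING to `ReadOutAt D R.u3 ∧ N18At R.u3 ∧ N22At R.u3`: at every `Rg`-admissible
tuple with (B) ∧ endpoint existence — ONE tuned `g₀` (FILE 1 §1), `os := []`, §1 at the selected run length; plus the six letter signs.  EDITION-PROOF: v4's `PHolderD4` is one such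
`P` (next theorem); a successor skeleton that re-pins N14∕N15∕N16 but keeps (D4) ∧ N18 ∧ N22 at `R.u3` is another. [bookkeeping] -/
theorem u2Inputs_bare_of_keyedP_fsc_pin (hproj : ∀ {F : T4Family} (D : Datum F N) (R : RateCarriers N), P D R → ReadOutAt D R.u3 ∧ N18At R.u3 ∧ N22At R.u3)
    (𝔯 : RateReading₁₃CoPH N) (ℓ : (F : T4Family) → Stage13HParams F N → U3Letters₁₁)
    (ksel : (F : T4Family) → (θ : Stage13HParams F N) → θ.Provisos₁₃CoPH F N → (ℕ → ℝ) → List (ULoop F) → ℕ)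
    (hpin : ∀ (F : T4Family) (θ : Stage13HParams F N) (hP : θ.Provisos₁₃CoPH F N) (g₀ : ℕ → ℝ) (os : List (ULoop F)),
      (𝔯.lit F θ hP g₀ os).u3 = objectsOfRecord₁₃ F N θ.toStage13Params (ℓ F θ))
    (hr : ∀ (F : T4Family) (θ : Stage13HParams F N) (hP : θ.Provisos₁₃CoPH F N), Rg F θ → θ.Admissible F N →
      B16.EndStatementBPrinted (datumOfRecord₁₃CoPH F N θ hP).C → DagBinding.EndpointExistence (datumOfRecord₁₃CoPH F N θ hP).C.toB12 →
        ForSmallCouplings (datumOfRecord₁₃CoPH F N θ hP) fun g₀ => ∀ os : List (ULoop F),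
          P (datumOfRecord₁₃CoPH F N θ hP) (rateCarriersOfRecord₁₃CoPH 𝔯 F θ hP g₀ os (ksel F θ hP g₀ os)))
    (F : T4Family) (θ : Stage13HParams F N) (hP : θ.Provisos₁₃CoPH F N) (hRg : Rg F θ) (hθ : θ.Admissible F N)
    (hB : B16.EndStatementBPrinted (datumOfRecord₁₃CoPH F N θ hP).C) (hex : DagBinding.EndpointExistence (datumOfRecord₁₃CoPH F N θ hP).C.toB12) :
    U2Inputs (datumOfRecord₁₃CoPH F N θ hP) ((ℓ F θ).cr * (ℓ F θ).C₅ * (ℓ F θ).θ₅) ((ℓ F θ).cr * (ℓ F θ).C₉ * (ℓ F θ).ω) (ℓ F θ).ρ θ.γ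
        (fun a i => (ℓ F θ).cr * (ℓ F θ).moduli (a + 1) i) ∧
      (0 ≤ (ℓ F θ).cr ∧ 0 ≤ (ℓ F θ).C₅ ∧ 0 ≤ (ℓ F θ).θ₅ ∧ 0 ≤ (ℓ F θ).ω ∧ (ℓ F θ).θ₅ ≤ (ℓ F θ).ρ ∧ (ℓ F θ).ω ≤ (ℓ F θ).ρ) := by
  obtain ⟨g₀, hg₀⟩ := exists_of_forSmallCouplings hex (hr F θ hP hRg hθ hB hex)
  obtain ⟨hD4, h18, h22⟩ := hproj _ _ (hg₀ [])
  exact ⟨u2Inputs_bare_of_readOut_n18_n22_pin 𝔯 ℓ θ hP (hpin F θ hP) g₀ [] _ hD4 h18 h22,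
    letterSigns_of_readOutAt_pin 𝔯 ℓ θ hP (hpin F θ hP) g₀ [] _ hD4⟩

/-- **… AT v4's `PHolderD4` (SPELLED)** — `KeyedRatesHolderD4 β (rrOfRecord 𝔯 ksel)` + the pin ⟹ bare triple ∧ signs ∧ the junction letter `0 ≤ (ℓ F θ).ρ < 1` (FILE 1 `rho_rrOfRecord_eq_of_pin`).
[bookkeeping] -/
theorem u2Inputs_bare_of_keyedRatesHolderD4_fsc_pin {β : ℝ} (𝔯 : RateReading₁₃CoPH N) (ℓ : (F : T4Family) → Stage13HParams F N → U3Letters₁₁)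
    (ksel : (F : T4Family) → (θ : Stage13HParams F N) → θ.Provisos₁₃CoPH F N → (ℕ → ℝ) → List (ULoop F) → ℕ)
    (hpin : ∀ (F : T4Family) (θ : Stage13HParams F N) (hP : θ.Provisos₁₃CoPH F N) (g₀ : ℕ → ℝ) (os : List (ULoop F)),
      (𝔯.lit F θ hP g₀ os).u3 = objectsOfRecord₁₃ F N θ.toStage13Params (ℓ F θ))
    (hr : ∀ (F : T4Family) (θ : Stage13HParams F N) (hP : θ.Provisos₁₃CoPH F N), Rg F θ → θ.Admissible F N →
      B16.EndStatementBPrinted (datumOfRecord₁₃CoPH F N θ hP).C → DagBinding.EndpointExistence (datumOfRecord₁₃CoPH F N θ hP).C.toB12 →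
        ForSmallCouplings (datumOfRecord₁₃CoPH F N θ hP) fun g₀ => ∀ os : List (ULoop F),
          RatesHolderAt (datumOfRecord₁₃CoPH F N θ hP) (rateCarriersOfRecord₁₃CoPH 𝔯 F θ hP g₀ os (ksel F θ hP g₀ os)) β ∧
            ReadOutAt (datumOfRecord₁₃CoPH F N θ hP) (rateCarriersOfRecord₁₃CoPH 𝔯 F θ hP g₀ os (ksel F θ hP g₀ os)).u3 ∧
            (0 ≤ (rateCarriersOfRecord₁₃CoPH 𝔯 F θ hP g₀ os (ksel F θ hP g₀ os)).u3.ρ ∧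
              (rateCarriersOfRecord₁₃CoPH 𝔯 F θ hP g₀ os (ksel F θ hP g₀ os)).u3.ρ < 1))
    (F : T4Family) (θ : Stage13HParams F N) (hP : θ.Provisos₁₃CoPH F N) (hRg : Rg F θ) (hθ : θ.Admissible F N)
    (hB : B16.EndStatementBPrinted (datumOfRecord₁₃CoPH F N θ hP).C) (hex : DagBinding.EndpointExistence (datumOfRecord₁₃CoPH F N θ hP).C.toB12) :
    U2Inputs (datumOfRecord₁₃CoPH F N θ hP) ((ℓ F θ).cr * (ℓ F θ).C₅ * (ℓ F θ).θ₅) ((ℓ F θ).cr * (ℓ F θ).C₉ * (ℓ F θ).ω) (ℓ F θ).ρ θ.γ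
        (fun a i => (ℓ F θ).cr * (ℓ F θ).moduli (a + 1) i) ∧
      (0 ≤ (ℓ F θ).cr ∧ 0 ≤ (ℓ F θ).C₅ ∧ 0 ≤ (ℓ F θ).θ₅ ∧ 0 ≤ (ℓ F θ).ω ∧ (ℓ F θ).θ₅ ≤ (ℓ F θ).ρ ∧ (ℓ F θ).ω ≤ (ℓ F θ).ρ) ∧
      (0 ≤ (ℓ F θ).ρ ∧ (ℓ F θ).ρ < 1) := by
  obtain ⟨hI, hs⟩ := u2Inputs_bare_of_keyedP_fsc_pin Rg (fun D R => RatesHolderAt D R β ∧ ReadOutAt D R.u3 ∧ (0 ≤ R.u3.ρ ∧ R.u3.ρ < 1))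
    (fun _ _ h => ⟨h.2.1, h.1.2.2.2.2.1, h.1.2.2.2.2.2⟩) 𝔯 ℓ ksel hpin hr F θ hP hRg hθ hB hex
  exact ⟨hI, hs, (scaleShiftRate_betaOfRecord₁₃_of_keyedRatesHolderD4_fsc_pin Rg 𝔯 ℓ ksel hpin hr F θ hP hRg hθ hB hex).2⟩

/-! ## §3 ★★ … ⟹ NODE U2's OUTPUT UNDER THE TARGETS' PREFIX AT `Hβ := EndpointExistence` — AF-free, window-free, NO separate antecedent -/

/-- ★★ **ANY FSC-KEYED RATES PREDICATE PROJECTING TO (D4) ∧ N18 ∧ N22, PINNED, FEEDS THE `hU2` SLOT OF RECORD.**  `P` keyed as v4 keys its rates (guard `Rg` arbitrary), the node-U3 pin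
`U3PinnedKernels 𝔯 ℓ` SPELLED, the PRINTED-type upper bound (U) `BetaUpperH β′ θ.γ (betaOfRecord₁₃ F N θ.toStage13Params)` with `θ.γ²·β′ < 1` and a non-empty window `0 < θ.γ` give,
at every `Rg`-admissible tuple and for EVERY output rate `ρ′` with `(ℓ F θ).ρ < ρ′ < 1`,
`(datumOfRecord₁₃CoPH F N θ hP).UnderHypotheses (EndpointExistence …) (fun g₀ => U2Output … g₀ (2·((ℓ F θ).cr·(ℓ F θ).C₅·(ℓ F θ).θ₅)∕(1−ρ′)) ρ′)` — the `hU2` hypothesis shape of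
dag-n27-a's ledger joins at `Hβ := EndpointExistence`, `Cd := 2c∕(1−ρ′)`, `θc := ρ′`.  Road: the slot's own prefix hands over (B) and endpoint existence; §2 extracts the bare triple and
the signs at the one tuned sequence they guarantee; dag-n17-a's `u2Output_under_of_u2Inputs_gap` (AF-free gap road: memory rate `ρ` < output rate `ρ′`, the γ³-window discharged by
`γ` small INSIDE the prefix) concludes; the sign `0 ≤ cr·C₉·ω` of the memory constant from the triple's own `FadingMemory` conjunct (`T4BetaReadOut.fadingMemory_const_nonneg`), `0 ≤ ρ`
from `0 ≤ θ₅ ≤ ρ`.  NO `EventualLowerH`, NO window binder, NO separate (B)∕endpoint hypothesis, NO `ρ < 1`. [bookkeeping] -/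
theorem underHypotheses_u2Output_of_keyedP_fsc_pin
    (hproj : ∀ {F : T4Family} (D : Datum F N) (R : RateCarriers N), P D R → ReadOutAt D R.u3 ∧ N18At R.u3 ∧ N22At R.u3)
    (𝔯 : RateReading₁₃CoPH N) (ℓ : (F : T4Family) → Stage13HParams F N → U3Letters₁₁)
    (ksel : (F : T4Family) → (θ : Stage13HParams F N) → θ.Provisos₁₃CoPH F N → (ℕ → ℝ) → List (ULoop F) → ℕ)
    (hpin : ∀ (F : T4Family) (θ : Stage13HParams F N) (hP : θ.Provisos₁₃CoPH F N) (g₀ : ℕ → ℝ) (os : List (ULoop F)),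
      (𝔯.lit F θ hP g₀ os).u3 = objectsOfRecord₁₃ F N θ.toStage13Params (ℓ F θ))
    (hr : ∀ (F : T4Family) (θ : Stage13HParams F N) (hP : θ.Provisos₁₃CoPH F N), Rg F θ → θ.Admissible F N →
      B16.EndStatementBPrinted (datumOfRecord₁₃CoPH F N θ hP).C → DagBinding.EndpointExistence (datumOfRecord₁₃CoPH F N θ hP).C.toB12 →
        ForSmallCouplings (datumOfRecord₁₃CoPH F N θ hP) fun g₀ => ∀ os : List (ULoop F),
          P (datumOfRecord₁₃CoPH F N θ hP) (rateCarriersOfRecord₁₃CoPH 𝔯 F θ hP g₀ os (ksel F θ hP g₀ os)))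
    (F : T4Family) (θ : Stage13HParams F N) (hP : θ.Provisos₁₃CoPH F N) (hRg : Rg F θ) (hθ : θ.Admissible F N)
    (hγ : 0 < θ.γ) {β' : ℝ} (hhi : BetaUpperH β' θ.γ (betaOfRecord₁₃ F N θ.toStage13Params)) (hγβ : θ.γ ^ 2 * β' < 1)
    {ρ' : ℝ} (hρρ' : (ℓ F θ).ρ < ρ') (hρ'1 : ρ' < 1) :
    (datumOfRecord₁₃CoPH F N θ hP).UnderHypotheses (DagBinding.EndpointExistence (datumOfRecord₁₃CoPH F N θ hP).C.toB12)
      fun g₀ => U2Output (datumOfRecord₁₃CoPH F N θ hP) g₀ (2 * ((ℓ F θ).cr * (ℓ F θ).C₅ * (ℓ F θ).θ₅) / (1 - ρ')) ρ' := by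
  intro hB hex
  obtain ⟨hI, hcr, hC₅, hθ₅, -, hθρ, -⟩ := u2Inputs_bare_of_keyedP_fsc_pin Rg P hproj 𝔯 ℓ ksel hpin hr F θ hP hRg hθ hB hex
  -- the triple's fading-memory conjunct carries the sign of its constant `cr·C₉·ω` (the two `FadingMemory` shapes agree definitionally)
  have hC : 0 ≤ (ℓ F θ).cr * (ℓ F θ).C₉ * (ℓ F θ).ω :=
    T4BetaReadOut.fadingMemory_const_nonneg (show T4OutputRate.FadingMemory _ _ _ from hI.2.2)
  have hhi' : BetaUpperH β' θ.γ (datumOfRecord₁₃CoPH F N θ hP).βfun := by rwa [βfun_datumOfRecord₁₃CoPH]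
  exact u2Output_under_of_u2Inputs_gap (datumOfRecord₁₃CoPH F N θ hP) hI (mul_nonneg (mul_nonneg hcr hC₅) hθ₅) hC (hθ₅.trans hθρ) hρρ' hρ'1 hγ
    hhi' hγβ hB hex

/-- ★★ **… AT v4's `PHolderD4` (SPELLED)**: K3⁷ v4's `KeyedRatesHolderD4 β (rrOfRecord 𝔯 ksel)` + the pin + (U) + `0 < θ.γ` ⟹ the `hU2` slot at `Hβ := EndpointExistence` for every
`ρ′ ∈ ](ℓ F θ).ρ, 1[`. [bookkeeping] -/
theorem underHypotheses_u2Output_of_keyedRatesHolderD4_fsc_pin {β : ℝ} (𝔯 : RateReading₁₃CoPH N) (ℓ : (F : T4Family) → Stage13HParams F N → U3Letters₁₁)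
    (ksel : (F : T4Family) → (θ : Stage13HParams F N) → θ.Provisos₁₃CoPH F N → (ℕ → ℝ) → List (ULoop F) → ℕ)
    (hpin : ∀ (F : T4Family) (θ : Stage13HParams F N) (hP : θ.Provisos₁₃CoPH F N) (g₀ : ℕ → ℝ) (os : List (ULoop F)),
      (𝔯.lit F θ hP g₀ os).u3 = objectsOfRecord₁₃ F N θ.toStage13Params (ℓ F θ))
    (hr : ∀ (F : T4Family) (θ : Stage13HParams F N) (hP : θ.Provisos₁₃CoPH F N), Rg F θ → θ.Admissible F N →
      B16.EndStatementBPrinted (datumOfRecord₁₃CoPH F N θ hP).C → DagBinding.EndpointExistence (datumOfRecord₁₃CoPH F N θ hP).C.toB12 →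
        ForSmallCouplings (datumOfRecord₁₃CoPH F N θ hP) fun g₀ => ∀ os : List (ULoop F),
          RatesHolderAt (datumOfRecord₁₃CoPH F N θ hP) (rateCarriersOfRecord₁₃CoPH 𝔯 F θ hP g₀ os (ksel F θ hP g₀ os)) β ∧
            ReadOutAt (datumOfRecord₁₃CoPH F N θ hP) (rateCarriersOfRecord₁₃CoPH 𝔯 F θ hP g₀ os (ksel F θ hP g₀ os)).u3 ∧
            (0 ≤ (rateCarriersOfRecord₁₃CoPH 𝔯 F θ hP g₀ os (ksel F θ hP g₀ os)).u3.ρ ∧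
              (rateCarriersOfRecord₁₃CoPH 𝔯 F θ hP g₀ os (ksel F θ hP g₀ os)).u3.ρ < 1))
    (F : T4Family) (θ : Stage13HParams F N) (hP : θ.Provisos₁₃CoPH F N) (hRg : Rg F θ) (hθ : θ.Admissible F N)
    (hγ : 0 < θ.γ) {β' : ℝ} (hhi : BetaUpperH β' θ.γ (betaOfRecord₁₃ F N θ.toStage13Params)) (hγβ : θ.γ ^ 2 * β' < 1)
    {ρ' : ℝ} (hρρ' : (ℓ F θ).ρ < ρ') (hρ'1 : ρ' < 1) :
    (datumOfRecord₁₃CoPH F N θ hP).UnderHypotheses (DagBinding.EndpointExistence (datumOfRecord₁₃CoPH F N θ hP).C.toB12)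
      fun g₀ => U2Output (datumOfRecord₁₃CoPH F N θ hP) g₀ (2 * ((ℓ F θ).cr * (ℓ F θ).C₅ * (ℓ F θ).θ₅) / (1 - ρ')) ρ' :=
  underHypotheses_u2Output_of_keyedP_fsc_pin Rg (fun D R => RatesHolderAt D R β ∧ ReadOutAt D R.u3 ∧ (0 ≤ R.u3.ρ ∧ R.u3.ρ < 1))
    (fun _ _ h => ⟨h.2.1, h.1.2.2.2.2.1, h.1.2.2.2.2.2⟩) 𝔯 ℓ ksel hpin hr F θ hP hRg hθ hγ hhi hγβ hρρ' hρ'1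

/-- **… EQUIVALENTLY IN v4's OWN FSC SHAPE** with (B) and endpoint existence displayed as hypotheses (`underHypotheses_iff` unfolded): `ForSmallCouplings D (fun g₀ => U2Output D g₀ … ρ′)`.
[bookkeeping] -/
theorem forSmallCouplings_u2Output_of_keyedRatesHolderD4_fsc_pin {β : ℝ} (𝔯 : RateReading₁₃CoPH N) (ℓ : (F : T4Family) → Stage13HParams F N → U3Letters₁₁)
    (ksel : (F : T4Family) → (θ : Stage13HParams F N) → θ.Provisos₁₃CoPH F N → (ℕ → ℝ) → List (ULoop F) → ℕ)
    (hpin : ∀ (F : T4Family) (θ : Stage13HParams F N) (hP : θ.Provisos₁₃CoPH F N) (g₀ : ℕ → ℝ) (os : List (ULoop F)),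
      (𝔯.lit F θ hP g₀ os).u3 = objectsOfRecord₁₃ F N θ.toStage13Params (ℓ F θ))
    (hr : ∀ (F : T4Family) (θ : Stage13HParams F N) (hP : θ.Provisos₁₃CoPH F N), Rg F θ → θ.Admissible F N →
      B16.EndStatementBPrinted (datumOfRecord₁₃CoPH F N θ hP).C → DagBinding.EndpointExistence (datumOfRecord₁₃CoPH F N θ hP).C.toB12 →
        ForSmallCouplings (datumOfRecord₁₃CoPH F N θ hP) fun g₀ => ∀ os : List (ULoop F),
          RatesHolderAt (datumOfRecord₁₃CoPH F N θ hP) (rateCarriersOfRecord₁₃CoPH 𝔯 F θ hP g₀ os (ksel F θ hP g₀ os)) β ∧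
            ReadOutAt (datumOfRecord₁₃CoPH F N θ hP) (rateCarriersOfRecord₁₃CoPH 𝔯 F θ hP g₀ os (ksel F θ hP g₀ os)).u3 ∧
            (0 ≤ (rateCarriersOfRecord₁₃CoPH 𝔯 F θ hP g₀ os (ksel F θ hP g₀ os)).u3.ρ ∧
              (rateCarriersOfRecord₁₃CoPH 𝔯 F θ hP g₀ os (ksel F θ hP g₀ os)).u3.ρ < 1))
    (F : T4Family) (θ : Stage13HParams F N) (hP : θ.Provisos₁₃CoPH F N) (hRg : Rg F θ) (hθ : θ.Admissible F N)
    (hB : B16.EndStatementBPrinted (datumOfRecord₁₃CoPH F N θ hP).C) (hex : DagBinding.EndpointExistence (datumOfRecord₁₃CoPH F N θ hP).C.toB12)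
    (hγ : 0 < θ.γ) {β' : ℝ} (hhi : BetaUpperH β' θ.γ (betaOfRecord₁₃ F N θ.toStage13Params)) (hγβ : θ.γ ^ 2 * β' < 1)
    {ρ' : ℝ} (hρρ' : (ℓ F θ).ρ < ρ') (hρ'1 : ρ' < 1) :
    ForSmallCouplings (datumOfRecord₁₃CoPH F N θ hP)
      fun g₀ => U2Output (datumOfRecord₁₃CoPH F N θ hP) g₀ (2 * ((ℓ F θ).cr * (ℓ F θ).C₅ * (ℓ F θ).θ₅) / (1 - ρ')) ρ' :=
  underHypotheses_u2Output_of_keyedRatesHolderD4_fsc_pin Rg 𝔯 ℓ ksel hpin hr F θ hP hRg hθ hγ hhi hγβ hρρ' hρ'1 hB hex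

/-! ## §4 From the whole v4 stub-1 ∃-shape: SOME letter reading with §3 at every guarded admissible tuple -/

/-- ★★ **WHAT K3⁷ v4's STUB 1 DELIVERS TO NODE U6 ∕ THE N27 JOINS' `hU2` SLOT**: from `∃ β, 2∕3 < β ∧ β < 1 ∧ ∃ 𝔯 ksel ℓ, G 𝔯 ksel ℓ ∧ KeyedRatesHolderD4 β (rrOfRecord 𝔯 ksel)` (rates
SPELLED; `G` ARBITRARY but implying the node-U3 pin — v4's `GuardedReading` does, fourth conjunct) there is SOME letter reading `ℓ` such that at every `Rg`-admissible tuple with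
`0 < θ.γ` and (U) `BetaUpperH β′ θ.γ β₁₃`, `θ.γ²β′ < 1`, node U2's output holds under the targets' prefix at `Hβ := EndpointExistence` for every `ρ′ ∈ ](ℓ F θ).ρ, 1[` with
constant `2·(cr·C₅·θ₅)∕(1−ρ′)`.  The v4 price list of the N17 → U2 → U6 edge: (U) and the rate loss, nothing else. [bookkeeping] -/
theorem exists_letters_underHypotheses_u2Output_of_stub_rates13H_shape_v4
    (G : RateReading₁₃CoPH N → ((F : T4Family) → (θ : Stage13HParams F N) → θ.Provisos₁₃CoPH F N → (ℕ → ℝ) → List (ULoop F) → ℕ) →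
      ((F : T4Family) → Stage13HParams F N → U3Letters₁₁) → Prop)
    (hG : ∀ 𝔯 ksel ℓ, G 𝔯 ksel ℓ → ∀ (F : T4Family) (θ : Stage13HParams F N) (hP : θ.Provisos₁₃CoPH F N) (g₀ : ℕ → ℝ) (os : List (ULoop F)),
      (𝔯.lit F θ hP g₀ os).u3 = objectsOfRecord₁₃ F N θ.toStage13Params (ℓ F θ))
    (h : ∃ β : ℝ, 2 / 3 < β ∧ β < 1 ∧
      ∃ (𝔯 : RateReading₁₃CoPH N) (ksel : (F : T4Family) → (θ : Stage13HParams F N) → θ.Provisos₁₃CoPH F N → (ℕ → ℝ) → List (ULoop F) → ℕ)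
        (ℓ : (F : T4Family) → Stage13HParams F N → U3Letters₁₁),
        G 𝔯 ksel ℓ ∧
        ∀ (F : T4Family) (θ : Stage13HParams F N) (hP : θ.Provisos₁₃CoPH F N), Rg F θ → θ.Admissible F N →
          B16.EndStatementBPrinted (datumOfRecord₁₃CoPH F N θ hP).C → DagBinding.EndpointExistence (datumOfRecord₁₃CoPH F N θ hP).C.toB12 →
            ForSmallCouplings (datumOfRecord₁₃CoPH F N θ hP) fun g₀ => ∀ os : List (ULoop F),
              RatesHolderAt (datumOfRecord₁₃CoPH F N θ hP) (rateCarriersOfRecord₁₃CoPH 𝔯 F θ hP g₀ os (ksel F θ hP g₀ os)) β ∧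
                ReadOutAt (datumOfRecord₁₃CoPH F N θ hP) (rateCarriersOfRecord₁₃CoPH 𝔯 F θ hP g₀ os (ksel F θ hP g₀ os)).u3 ∧
                (0 ≤ (rateCarriersOfRecord₁₃CoPH 𝔯 F θ hP g₀ os (ksel F θ hP g₀ os)).u3.ρ ∧
                  (rateCarriersOfRecord₁₃CoPH 𝔯 F θ hP g₀ os (ksel F θ hP g₀ os)).u3.ρ < 1)) :
    ∃ ℓ : (F : T4Family) → Stage13HParams F N → U3Letters₁₁,
      ∀ (F : T4Family) (θ : Stage13HParams F N) (hP : θ.Provisos₁₃CoPH F N), Rg F θ → θ.Admissible F N → 0 < θ.γ →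
        ∀ β' : ℝ, BetaUpperH β' θ.γ (betaOfRecord₁₃ F N θ.toStage13Params) → θ.γ ^ 2 * β' < 1 →
          ∀ ρ' : ℝ, (ℓ F θ).ρ < ρ' → ρ' < 1 →
            (datumOfRecord₁₃CoPH F N θ hP).UnderHypotheses (DagBinding.EndpointExistence (datumOfRecord₁₃CoPH F N θ hP).C.toB12)
              fun g₀ => U2Output (datumOfRecord₁₃CoPH F N θ hP) g₀ (2 * ((ℓ F θ).cr * (ℓ F θ).C₅ * (ℓ F θ).θ₅) / (1 - ρ')) ρ' := by
  obtain ⟨β, -, -, 𝔯, ksel, ℓ, hg, hr⟩ := h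
  exact ⟨ℓ, fun F θ hP hRg hθ hγ β' hhi hγβ ρ' hρρ' hρ'1 =>
    underHypotheses_u2Output_of_keyedRatesHolderD4_fsc_pin Rg 𝔯 ℓ ksel (hG 𝔯 ksel ℓ hg) hr F θ hP hRg hθ hγ hhi hγβ hρρ' hρ'1⟩

end Keyed

end YMDAG.N17.KeyedRatesFSC
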